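import Mathlib
import Summits.Ventures.PercRepro2.Defs
import Summits.Ventures.PercRepro2.Harris
import Summits.Ventures.PercRepro2.Graph
import Summits.Ventures.PercRepro2.Events
import Summits.Ventures.PercRepro2.Induced
import Summits.Ventures.PercRepro2.VdBKahn
import Summits.Ventures.PercRepro2.BHKEvents
import Summits.Ventures.PercRepro2.ContractDefs

/-!
# Row 2′CON-W, form (CCT-W), when the ROOT is the contracted representative
(blind cell PercRepro2, mine-1 g25; `proofs/MINE1-J1.md` §30(b1) and addendum 3)

Mine-c's row 2′CON-W (`ContractDefs.lean`) is stated for a root `s ∉ W`.  This file settles the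
complementary case in which the root IS the representative `w₀ ∈ W` of the contracted set — the
cluster of the root in `H/W` is then the union of the `H`-clusters of the vertices of `W` — for a
single avoided vertex `t` and markers `a, b` outside `W`:

  `CCTW_root : CCTW p ends w₀ {t} W w₀ a b`.

Proof.  Write `X₁ = P(a ∈ C_{H/W}(w₀); w₀ ↛_{H/W} t)`, `Y₁`, `A₁` for the merged events, `Q₁` for
the merged avoidance, and `X₀, Y₀, Q₀` for the plain ones.  (i) `vdBK` on `H/W` gives
`X₁ Y₁ ≤ A₁ Q₁` (BHK 1.3 on the contracted graph).  (ii) From the representative, `H/W` reaches exactly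
the vertices that SOME vertex of `W` reaches in `H` (`conn_contract_root_iff`), so the merged avoidance
is «the cluster of `t` avoids `W`», a decreasing event of `C_H(t)`; BHK 1.4 (`bhk_cross_cluster`: the
cluster of `w₀` and the cluster of `t` are negatively correlated given `w₀ ↮ t`) gives
`X₁ Q₀ ≥ X₀ Q₁` and `Y₁ Q₀ ≥ Y₀ Q₁` — BOTH displacements of the conditional means under the
contraction are nonnegative.  (iii) Then `Q₁ · (cleared form) ≥ (X₁ Q₀ − X₀ Q₁)(Y₁ Q₀ − Y₀ Q₁) ≥ 0`.
For a root outside `W` the displacements have no sign (`proofs/MINE1-J1.md` §29 add. 3) and the row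
is open.
-/

namespace Summit.Ventures.PercRepro2

namespace Contract

/-! ## Reaching out of the contracted set from its representative -/

section RootConn

variable {V : Type*} {E : Type*} [DecidableEq V] {ends : E → Sym2 V} {W : Finset V} {w₀ : V}
  {ω : Config E}

/-- From the representative `w₀ ∈ W`, `H/W` reaches a vertex `v ∉ W` iff some vertex of `W`
reaches `v` in `H`. -/
theorem conn_contract_root_iff (hw₀ : w₀ ∈ W) {v : V} (hv : v ∉ W) :
    Conn (contractEnds ends W w₀) ω w₀ v ↔ ∃ w ∈ W, Conn ends ω w v := by
  constructor
  · intro h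
    -- the vertices reached in `H` from some vertex of `W` form a set closed under `H/W`-adjacency
    let S : Set V := {z | ∃ w ∈ W, Conn ends ω w z}
    have hS : ∀ x ∈ S, ∀ y, (openGraph (contractEnds ends W w₀) ω).Adj x y → y ∈ S := by
      intro x hx y hxy
      obtain ⟨_, e, he, hends⟩ := openGraph_adj.1 hxy
      rw [contractEnds_apply] at hends
      -- unpack the ends of `e`
      have key : ∀ u₁ u₂ : V, ends e = s(u₁, u₂) → y ∈ S := by
        intro u₁ u₂ hu
        rw [hu, Sym2.map_mk, Sym2.eq_iff] at hends
        have hconn : Conn ends ω u₁ u₂ := conn_of_openAdj ⟨e, he, hu⟩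
        -- helper: if `π u = x` with `x ∈ S` then some vertex of `W` reaches `u` in `H`
        have reach : ∀ u : V, contractMap W w₀ u = x → ∃ w ∈ W, Conn ends ω w u := by
          intro u hu'
          by_cases huW : u ∈ W
          · exact ⟨u, huW, conn_refl _ _ _⟩
          · rw [contractMap_of_notMem huW] at hu'
            rw [hu']
            exact hx
        -- helper: the image of `u` lies in `S` as soon as some vertex of `W` reaches `u`
        have image : ∀ u : V, (∃ w ∈ W, Conn ends ω w u) → contractMap W w₀ u ∈ S := by
          rintro u ⟨w, hw, hwu⟩
          by_cases huW : u ∈ W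
          · rw [contractMap_of_mem huW]
            exact ⟨w₀, hw₀, conn_refl _ _ _⟩
          · rw [contractMap_of_notMem huW]
            exact ⟨w, hw, hwu⟩
        rcases hends with ⟨h1, h2⟩ | ⟨h1, h2⟩
        · rw [← h2]
          obtain ⟨w, hw, hw1⟩ := reach u₁ h1
          exact image u₂ ⟨w, hw, conn_trans hw1 hconn⟩
        · rw [← h1]
          obtain ⟨w, hw, hw2⟩ := reach u₂ h2
          exact image u₁ ⟨w, hw, conn_trans hw2 (conn_symm hconn)⟩
      exact (@Sym2.ind V (fun q => ends e = q → y ∈ S) key) (ends e) rfl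
    have hmem : w₀ ∈ S := ⟨w₀, hw₀, conn_refl _ _ _⟩
    exact mem_of_conn_of_closed hS hmem h
  · rintro ⟨w, hw, hwv⟩
    have := conn_contract_of_conn (W := W) (w₀ := w₀) hwv
    rwa [contractMap_of_mem hw, contractMap_of_notMem hv] at this

/-- A plain connection from the representative is a merged connection (`v ∉ W`). -/
lemma conn_contract_root_of_conn (hw₀ : w₀ ∈ W) {v : V} (hv : v ∉ W) (h : Conn ends ω w₀ v) :
    Conn (contractEnds ends W w₀) ω w₀ v :=
  (conn_contract_root_iff hw₀ hv).2 ⟨w₀, hw₀, h⟩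

end RootConn

/-! ## The theorem -/

section Main

variable {V : Type*} {E : Type*} [Fintype V] [DecidableEq V] [Fintype E] [DecidableEq E]
  {R : Type*} [Field R] [LinearOrder R] [IsStrictOrderedRing R]

omit [Fintype V] [DecidableEq V] [Fintype E] [DecidableEq E] in
/-- «The cluster contains `a`» is an up-set of vertex sets. -/
lemma isUpperSet_memUp (a : V) : IsUpperSet {S : Set V | a ∈ S} := fun _ _ h ha => h ha

omit [Fintype V] [DecidableEq V] [Fintype E] [DecidableEq E] in
/-- «The cluster meets `W`» is an up-set of vertex sets. -/
lemma isUpperSet_hitsUp (W : Finset V) : IsUpperSet {S : Set V | ∃ w ∈ W, w ∈ S} :=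
  fun _ _ h ⟨w, hw, hwS⟩ => ⟨w, hw, h hwS⟩

omit [Fintype V] [Fintype E] [DecidableEq E] in
/-- The merged avoidance of a single vertex `t ∉ W` from the representative is «the cluster of `t`
avoids `W`». -/
lemma avoidAll_contract_root (ends : E → Sym2 V) {W : Finset V} {w₀ : V} (hw₀ : w₀ ∈ W) {t : V}
    (ht : t ∉ W) :
    avoidAll (contractEnds ends W w₀) w₀ {t} = (clusterInEvent ends t {S : Set V | ∃ w ∈ W, w ∈ S})ᶜ := by
  ext ω
  simp only [avoidAll, Set.mem_setOf_eq, Finset.mem_singleton, forall_eq, Set.mem_compl_iff,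
    mem_clusterInEvent, Set.mem_setOf_eq, mem_cluster, conn_contract_root_iff hw₀ ht]
  constructor
  · rintro h ⟨w, hw, hwt⟩
    exact h ⟨w, hw, conn_symm hwt⟩
  · rintro h ⟨w, hw, hwt⟩
    exact h ⟨w, hw, conn_symm hwt⟩

omit [Fintype V] [DecidableEq V] [Fintype E] [DecidableEq E] in
/-- The plain connection event to a marker, as a cluster event. -/
lemma connAll_singleton_eq (ends : E → Sym2 V) (s a : V) :
    connAll ends s {a} = clusterInEvent ends s {S : Set V | a ∈ S} := by
  ext ω
  simp [connAll, clusterInEvent, cluster]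

omit [Fintype V] [DecidableEq V] [Fintype E] [DecidableEq E] in
/-- The plain avoidance of a single vertex is the complement of the connection event. -/
lemma avoidAll_singleton_eq (ends : E → Sym2 V) (s t : V) :
    avoidAll ends s {t} = (connEvent ends s t)ᶜ := by
  ext ω
  simp [avoidAll, connEvent]

omit [Fintype V] [DecidableEq V] [Fintype E] [DecidableEq E] in
/-- «The cluster of `t` avoids `W ∋ w₀`» implies `w₀ ↮ t`. -/
lemma compl_hits_subset_avoid (ends : E → Sym2 V) {W : Finset V} {w₀ : V} (hw₀ : w₀ ∈ W)
    (t : V) : (clusterInEvent ends t {S : Set V | ∃ w ∈ W, w ∈ S})ᶜ ⊆ (connEvent ends w₀ t)ᶜ := by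
  intro ω h hc
  exact h ⟨w₀, hw₀, conn_symm hc⟩

/-- **(CCT-W) with the root as the representative of the contracted set**: for `w₀ ∈ W`, a single
avoided vertex `t ∉ W` and markers `a, b ∉ W`, the contraction–deletion centred form of row 2′CON-W
holds — both displacements of the conditional means are nonnegative (BHK 1.4) and BHK 1.3 on `H/W`
does the rest. -/
theorem CCTW_root (p : E → R) (hp : IsProbVec p) (ends : E → Sym2 V) {W : Finset V} {w₀ : V}
    (hw₀ : w₀ ∈ W) {t a b : V} (ht : t ∉ W) (ha : a ∉ W) (hb : b ∉ W) :
    CCTW p ends w₀ {t} W w₀ a b := by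
  unfold CCTW
  set ends' := contractEnds ends W w₀ with hends'
  -- names
  set Q0 := prob p (avoidAll ends w₀ {t}) with hQ0
  set Q1 := prob p (avoidAll ends' w₀ {t}) with hQ1
  set X0 := prob p (connAll ends w₀ {a} ∩ avoidAll ends w₀ {t}) with hX0
  set Y0 := prob p (connAll ends w₀ {b} ∩ avoidAll ends w₀ {t}) with hY0
  set X1 := prob p (connAll ends' w₀ {a} ∩ avoidAll ends' w₀ {t}) with hX1
  set Y1 := prob p (connAll ends' w₀ {b} ∩ avoidAll ends' w₀ {t}) with hY1
  set A1 := prob p (connAll ends' w₀ ({a} ∪ {b}) ∩ avoidAll ends' w₀ {t}) with hA1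
  -- (i) BHK 1.3 on `H/W`
  have h1 : X1 * Y1 ≤ A1 * Q1 := by
    have h := vdBK p hp ends' w₀ {a} {b} {t} {t}
    rwa [Finset.inter_self, Finset.union_self] at h
  -- (ii) the displacements, via BHK 1.4 on `H`
  have disp : ∀ c : V, c ∉ W →
      prob p (connAll ends w₀ {c} ∩ avoidAll ends w₀ {t}) * Q1 ≤
        prob p (connAll ends' w₀ {c} ∩ avoidAll ends' w₀ {t}) * Q0 := by
    intro c hc
    have hcross := bhk_cross_cluster p hp ends w₀ t (isUpperSet_memUp c) (isUpperSet_hitsUp W)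
    set Rt := (connEvent ends w₀ t)ᶜ with hRt
    set B := clusterInEvent ends t {S : Set V | ∃ w ∈ W, w ∈ S} with hB
    set C := clusterInEvent ends w₀ {S : Set V | c ∈ S} with hC
    -- `hcross : P(C ∩ B ∩ Rt) · P(Rt) ≤ P(C ∩ Rt) · P(B ∩ Rt)`
    have hsplit := prob_inter_add_prob_inter_compl p (C ∩ Rt) B
    have hsplitQ := prob_inter_add_prob_inter_compl p Rt B
    have hN : Rt ∩ Bᶜ = Bᶜ := Set.inter_eq_right.2 (compl_hits_subset_avoid ends hw₀ t)
    have e1 : C ∩ Rt ∩ B = C ∩ B ∩ Rt := by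
      ext ω; simp only [Set.mem_inter_iff]; tauto
    have e2 : C ∩ Rt ∩ Bᶜ = C ∩ Bᶜ := by rw [Set.inter_assoc, hN]
    have e3 : Rt ∩ B = B ∩ Rt := Set.inter_comm _ _
    rw [e1, e2] at hsplit
    rw [hN, e3] at hsplitQ
    -- the merged term dominates the plain term on «the cluster of `t` avoids `W`»
    have hsub : C ∩ Bᶜ ⊆ connAll ends' w₀ {c} ∩ avoidAll ends' w₀ {t} := by
      rintro ω ⟨hωc, hωt⟩
      refine ⟨?_, ?_⟩
      · simp only [connAll, Set.mem_setOf_eq, Finset.mem_singleton, forall_eq]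
        exact conn_contract_root_of_conn hw₀ hc hωc
      · rw [avoidAll_contract_root ends hw₀ ht]
        exact hωt
    have hmono := prob_mono hp hsub
    have eX : prob p (connAll ends w₀ {c} ∩ avoidAll ends w₀ {t}) = prob p (C ∩ Rt) := by
      rw [hC, hRt, connAll_singleton_eq, avoidAll_singleton_eq]
    have eQ0 : Q0 = prob p Rt := by rw [hQ0, hRt, avoidAll_singleton_eq]
    have eQ1 : Q1 = prob p Bᶜ := by rw [hQ1, hB, avoidAll_contract_root ends hw₀ ht]
    rw [eX, eQ0, eQ1]
    have hR0 : 0 ≤ prob p Rt := prob_nonneg hp _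
    have hBc : prob p Bᶜ = prob p Rt - prob p (B ∩ Rt) := by linarith [hsplitQ]
    have hCB : prob p (C ∩ Bᶜ) = prob p (C ∩ Rt) - prob p (C ∩ B ∩ Rt) := by linarith [hsplit]
    calc prob p (C ∩ Rt) * prob p Bᶜ
        = prob p (C ∩ Rt) * prob p Rt - prob p (C ∩ Rt) * prob p (B ∩ Rt) := by rw [hBc]; ring
      _ ≤ prob p (C ∩ Rt) * prob p Rt - prob p (C ∩ B ∩ Rt) * prob p Rt := by linarith [hcross]
      _ = prob p (C ∩ Bᶜ) * prob p Rt := by rw [hCB]; ring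
      _ ≤ prob p (connAll ends' w₀ {c} ∩ avoidAll ends' w₀ {t}) * prob p Rt :=
          mul_le_mul_of_nonneg_right hmono hR0
  have h2 : X0 * Q1 ≤ X1 * Q0 := disp a ha
  have h3 : Y0 * Q1 ≤ Y1 * Q0 := disp b hb
  -- nonnegativity
  have hQ0' : 0 ≤ Q0 := prob_nonneg hp _
  have hQ1' : 0 ≤ Q1 := prob_nonneg hp _
  have hX0' : 0 ≤ X0 := prob_nonneg hp _
  have hY0' : 0 ≤ Y0 := prob_nonneg hp _
  have hX1' : 0 ≤ X1 := prob_nonneg hp _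
  have hY1' : 0 ≤ Y1 := prob_nonneg hp _
  have hA1' : 0 ≤ A1 := prob_nonneg hp _
  -- (iii) the algebra
  rcases hQ1'.lt_or_eq with hpos | hzero
  · have key : 0 ≤ Q1 * (Q0 ^ 2 * A1 - Q0 * (X0 * Y1 + Y0 * X1) + X0 * Y0 * Q1) := by
      have hprod : 0 ≤ (X1 * Q0 - X0 * Q1) * (Y1 * Q0 - Y0 * Q1) :=
        mul_nonneg (sub_nonneg.2 h2) (sub_nonneg.2 h3)
      have hsq : 0 ≤ Q0 ^ 2 := sq_nonneg Q0
      nlinarith [mul_le_mul_of_nonneg_right h1 hsq, hprod]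
    exact (mul_nonneg_iff_of_pos_left hpos).1 key
  · -- `Q1 = 0`: the merged terms vanish
    have hsubX : connAll ends' w₀ {a} ∩ avoidAll ends' w₀ {t} ⊆ avoidAll ends' w₀ {t} :=
      Set.inter_subset_right
    have hsubY : connAll ends' w₀ {b} ∩ avoidAll ends' w₀ {t} ⊆ avoidAll ends' w₀ {t} :=
      Set.inter_subset_right
    have hsubA : connAll ends' w₀ ({a} ∪ {b}) ∩ avoidAll ends' w₀ {t} ⊆ avoidAll ends' w₀ {t} :=
      Set.inter_subset_right
    have hX1z : X1 = 0 := le_antisymm (by rw [hzero]; exact prob_mono hp hsubX) hX1'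
    have hY1z : Y1 = 0 := le_antisymm (by rw [hzero]; exact prob_mono hp hsubY) hY1'
    have hA1z : A1 = 0 := le_antisymm (by rw [hzero]; exact prob_mono hp hsubA) hA1'
    rw [hX1z, hY1z, hA1z, ← hzero]
    simp

end Main

end Contract

end Summit.Ventures.PercRepro2
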